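import Literature.AnabelianGeometry.EtaleTheta.Discharge.Sec5EnvelopeTopology

/-!
# [EtTh] §5, Lemma 5.8 / 5.9 (iv): the outer action of the constants on `E^Π_N` is a Kummer cocycle shift — proofs (pp. 331–332 / PDF pp. 105–106)

Mochizuki, *The étale theta function and its Frobenioid-theoretic manifestations*, Publ. RIMS **45**
(2009) [cite: MochizukiEtTh2009, Lem 5.8 p.105 (PRIMS p.331)].  Layer L2 of the abc-iut cell, seat
abc-iut-L2-t11 (wave-2 unit W2-L2-07).  PROOF-ONLY companion (no new definitions) of
abc-iut-L2-t4's `FrobenioidMonoThetaEnv.lean` / `FrobenioidEnvelopeIso.lean` over the dictionary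
file `Discharge/Sec5EnvelopeTopology.lean` (this seat).

Lemma 5.8: "we have a natural outer action of `(O_K^×)^{1/N}/μ_N(B_N) (⥲ O_K^×)` on `E_N`"; in
Lemma 5.9 (iv) this outer action (abc-iut-L2-t4's `constOut`: conjugation by `(u, 1)` on `E^Π_N` for
`u ∈ (O_K^×)^{1/N}`) must correspond, under `E^Π_N ⥲ Π^tp_Y[μ_N]`, to the `K^×`-part of `D_Y`
(abc-iut-L2-t2's `kummerOut`: shifts of `Π^tp_Y[μ_N]` by `μ_N`-valued cocycles inflated from `G_K`,
"the image of `K^×`", Def. 2.13 (i) p.47).  This file PROVES the cocycle computation behind that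
correspondence and thereby REDUCES the named hypothesis `ConstOutTransported` of
`Discharge/Sec5EnvelopeTopology.lean` to the arithmetic statement that the Kummer cocycle of a
constant is inflated from `G_K`:
* `coe_unitPart_conj_const`, `envIso_conj_const` — conjugation by `(u, 1)` (`u ∈ O^×(B_N)` acting on
  `Im(Π^tp_Y̲)`-sections "via multiplication by an element of `μ_N(B_N)`", proof of Lemma 5.8) is
  carried to `(a, y) ↦ (a · c_u(y), y)` with `c_u(y) = u · s^⊓-gp_N(ρ y) · u⁻¹ · s^⊓-gp_N(ρ y)⁻¹ ∈
  μ_N(B_N)` — the Kummer cocycle of the constant `u`;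
* `isEnvCocycle_of_inflated`, `congr_conj_const_eq_shift` — if `m ∘ c_u` is inflated from a function
  `δ₀` on `G_K` (hypothesis `hinfl`), the transported automorphism IS abc-iut-L2-t2's cocycle shift
  `CycEnvelope.shift` by `δ₀ ∘ aug`, which is then automatically bi-continuous;
* `transport_conjOut_const_mem_kummerOut`, `image_constOut_subset_DY`, `constOutTransported_of` —
  hence `constOut ↦ kummerOut ⊆ D_Y`, and `ConstOutTransported` holds given `hinfl` for every
  `u ∈ (O_K^×)^{1/N}` and the corresponding statement for the residual parameter `DK`.
HONEST FRAMING: discharges MODULO the hypotheses stated inline; [EtTh] is refereed; nothing of it is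
asserted unconditionally; typed ≠ proved; no side is taken on any disputed claim downstream.
-/

namespace Literature.AnabelianGeometry.EtaleTheta

open CategoryTheory

universe w v v' u u'

namespace ThetaFrobenioid

variable {C : Type u} [Category.{v} C] {D : Type u'} [Category.{v'} D]
  (𝔉 : ThetaFrobenioid.{w} C D)

/-- For `u ∈ O^×(B_N)` "on which `Π^tp_Y` acts via multiplication by an element of `μ_N(B_N)`"
(abc-iut-L2-t4's `ActsByCyclotome`, proof of Lemma 5.8) the Kummer cocycle value
`c_u(y) = u · s^⊓-gp_N(ρ y) · u⁻¹ · s^⊓-gp_N(ρ y)⁻¹` lies in `μ_N(B_N)` for `y ∈ Π^tp_Y̲`.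
[cite: MochizukiEtTh2009, Lem 5.8 proof p.105 (PRIMS p.331)] -/
theorem conj_comm_mem_muTorsion {u : Aut 𝔉.BN} (hu : 𝔉.ActsByCyclotome u) {y : 𝔉.PiX}
    (hy : y ∈ 𝔉.PiY) :
    u * 𝔉.sgpCap (𝔉.ρ y) * u⁻¹ * (𝔉.sgpCap (𝔉.ρ y))⁻¹ ∈ 𝔉.muTorsion 𝔉.BN 𝔉.N := by
  have h := (𝔉.muTorsion 𝔉.BN 𝔉.N).inv_mem (hu (𝔉.ρ y) ⟨y, hy, rfl⟩)
  have heq : (𝔉.sgpCap (𝔉.ρ y) * u * (𝔉.sgpCap (𝔉.ρ y))⁻¹ * u⁻¹)⁻¹ =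
      u * 𝔉.sgpCap (𝔉.ρ y) * u⁻¹ * (𝔉.sgpCap (𝔉.ρ y))⁻¹ := by group
  rwa [heq] at h

section Constants

variable (H : 𝔉.Facts) (T : ThetaEnvData.{v} 𝔉.N) (ι : 𝔉.PiX ≃ₜ* T.PiX)
  (m : 𝔉.muTorsion 𝔉.BN 𝔉.N ≃* T.mu) (hY : 𝔉.IdentifiesPiY T ι.toMulEquiv)
  (hχ : 𝔉.CyclotomicCharacterCompat T ι.toMulEquiv m)

/-- The `μ_N(B_N)`-component of the conjugate of `x = (e, y) ∈ E^Π_N` by `(u, 1)`, `u ∈ O^×(B_N)`: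
`unitPart((u,1) x (u,1)⁻¹) = unitPart(x) · c_u(y)` (`O^×(B_N)` is abelian, [FrdI] Rmk. 1.3.1).
[cite: MochizukiEtTh2009, Lem 5.8 proof p.105 (PRIMS p.331)] -/
theorem coe_unitPart_conj_const {u : Aut 𝔉.BN} (huU : u ∈ 𝔉.units 𝔉.BN)
    (hn : ((u, 1) : Aut 𝔉.BN × 𝔉.PiX) ∈ Subgroup.normalizer (𝔉.EPiN : Set (Aut 𝔉.BN × 𝔉.PiX)))
    (x : 𝔉.EPiN) :
    ((𝔉.unitPart H (𝔉.EPiN.normalizerMonoidHom ⟨(u, 1), hn⟩ x) : 𝔉.muTorsion 𝔉.BN 𝔉.N) :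
        Aut 𝔉.BN) =
      (𝔉.unitPart H x : Aut 𝔉.BN) *
        (u * 𝔉.sgpCap (𝔉.ρ x.1.2) * u⁻¹ * (𝔉.sgpCap (𝔉.ρ x.1.2))⁻¹) := by
  have hval : ((𝔉.EPiN.normalizerMonoidHom ⟨(u, 1), hn⟩ x : 𝔉.EPiN) : Aut 𝔉.BN × 𝔉.PiX) =
      ((u, 1) : Aut 𝔉.BN × 𝔉.PiX) * (x : Aut 𝔉.BN × 𝔉.PiX) * ((u, 1) : Aut 𝔉.BN × 𝔉.PiX)⁻¹ :=
    rfl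
  have h1 : (((u, 1) : Aut 𝔉.BN × 𝔉.PiX) * (x : Aut 𝔉.BN × 𝔉.PiX) *
      ((u, 1) : Aut 𝔉.BN × 𝔉.PiX)⁻¹).1 = u * x.1.1 * u⁻¹ := rfl
  have h2 : (((u, 1) : Aut 𝔉.BN × 𝔉.PiX) * (x : Aut 𝔉.BN × 𝔉.PiX) *
      ((u, 1) : Aut 𝔉.BN × 𝔉.PiX)⁻¹).2 = 1 * x.1.2 * 1⁻¹ := rfl
  have hcomm : u * (x.1.1 * (𝔉.sgpCap (𝔉.ρ x.1.2))⁻¹) = x.1.1 * (𝔉.sgpCap (𝔉.ρ x.1.2))⁻¹ * u :=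
    setLike_mul_comm (s := 𝔉.units 𝔉.BN) huU
      (𝔉.muTorsion_le_units 𝔉.BN 𝔉.N (𝔉.unitPart H x).2)
  rw [coe_unitPart, coe_unitPart, hval, h1, h2, one_mul, inv_one, mul_one]
  calc u * x.1.1 * u⁻¹ * (𝔉.sgpCap (𝔉.ρ x.1.2))⁻¹
      = u * (x.1.1 * (𝔉.sgpCap (𝔉.ρ x.1.2))⁻¹) * 𝔉.sgpCap (𝔉.ρ x.1.2) * u⁻¹ *
          (𝔉.sgpCap (𝔉.ρ x.1.2))⁻¹ := by group
    _ = x.1.1 * (𝔉.sgpCap (𝔉.ρ x.1.2))⁻¹ * u * 𝔉.sgpCap (𝔉.ρ x.1.2) * u⁻¹ *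
          (𝔉.sgpCap (𝔉.ρ x.1.2))⁻¹ := by rw [hcomm]
    _ = x.1.1 * (𝔉.sgpCap (𝔉.ρ x.1.2))⁻¹ *
          (u * 𝔉.sgpCap (𝔉.ρ x.1.2) * u⁻¹ * (𝔉.sgpCap (𝔉.ρ x.1.2))⁻¹) := by group

/-- **Conjugation by a constant is a Kummer shift, elementwise**: under `E^Π_N ⥲ Π^tp_Y[μ_N]`,
conjugation by `(u, 1)` (`u ∈ O^×(B_N)` acting by `μ_N(B_N)` on the sections) becomes
`(a, y) ↦ (a · m(c_u(y)), y)`.  [cite: MochizukiEtTh2009, Lem 5.8 p.105 (PRIMS p.331)] -/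
theorem envIso_conj_const {u : Aut 𝔉.BN} (huU : u ∈ 𝔉.units 𝔉.BN) (hu : 𝔉.ActsByCyclotome u)
    (hn : ((u, 1) : Aut 𝔉.BN × 𝔉.PiX) ∈ Subgroup.normalizer (𝔉.EPiN : Set (Aut 𝔉.BN × 𝔉.PiX)))
    (x : 𝔉.EPiN) :
    𝔉.envIso H T ι.toMulEquiv m hY hχ (𝔉.EPiN.normalizerMonoidHom ⟨(u, 1), hn⟩ x) =
      ⟨(𝔉.envIso H T ι.toMulEquiv m hY hχ x).left *
          m ⟨_, 𝔉.conj_comm_mem_muTorsion hu x.2.2.1⟩,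
        (𝔉.envIso H T ι.toMulEquiv m hY hχ x).right⟩ := by
  have hu' : 𝔉.unitPart H (𝔉.EPiN.normalizerMonoidHom ⟨(u, 1), hn⟩ x) =
      𝔉.unitPart H x * ⟨_, 𝔉.conj_comm_mem_muTorsion hu x.2.2.1⟩ :=
    Subtype.ext (𝔉.coe_unitPart_conj_const H huU hn x)
  ext
  · change m (𝔉.unitPart H _) = m (𝔉.unitPart H x) * m _
    rw [hu', map_mul]
  · change ι ((𝔉.EPiN.normalizerMonoidHom ⟨(u, 1), hn⟩ x : 𝔉.EPiN) : Aut 𝔉.BN × 𝔉.PiX).2 =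
      ι x.1.2
    change ι (1 * x.1.2 * 1⁻¹) = ι x.1.2
    rw [one_mul, inv_one, mul_one]

include hY hχ in
/-- **The Kummer cocycle of a constant, inflated**: if `m ∘ c_u` on `Π^tp_Y̲` factors as `δ₀ ∘ aug ∘ ι`
(hypothesis `hinfl`: the Kummer class of the constant `u` is INFLATED from `G_K` — in print `u` is an
`N`-th root of an element of `K^×`, on which `Π^tp_Y` acts through `Π^tp_Y ↠ G_K`; arithmetic, not
proved here), then `δ₀ ∘ aug` is a 1-cocycle of `Π^tp_Y` for the cyclotomic character (abc-iut-L2-t2's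
`CycEnvelope.IsEnvCocycle`).  [cite: MochizukiEtTh2009, Lem 5.8 p.105 (PRIMS p.331)] -/
theorem isEnvCocycle_of_inflated {u : Aut 𝔉.BN} (hu : 𝔉.ActsByCyclotome u) (δ₀ : T.G → T.mu)
    (hinfl : ∀ (y : 𝔉.PiX) (hy : y ∈ 𝔉.PiY)
      (hc : u * 𝔉.sgpCap (𝔉.ρ y) * u⁻¹ * (𝔉.sgpCap (𝔉.ρ y))⁻¹ ∈ 𝔉.muTorsion 𝔉.BN 𝔉.N),
      m ⟨_, hc⟩ = δ₀ (T.aug (ι y))) :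
    CycEnvelope.IsEnvCocycle T.augY T.chi (δ₀ ∘ T.augY) := by
  intro p q
  have hp : ι.symm (p : T.PiX) ∈ 𝔉.PiY :=
    (hY _).mpr (by change ι (ι.symm (p : T.PiX)) ∈ T.PiY; simp)
  have hq : ι.symm (q : T.PiX) ∈ 𝔉.PiY :=
    (hY _).mpr (by change ι (ι.symm (q : T.PiX)) ∈ T.PiY; simp)
  have hpq : ι.symm (p : T.PiX) * ι.symm (q : T.PiX) ∈ 𝔉.PiY := 𝔉.PiY.mul_mem hp hq
  have e1 := hinfl _ hpq (𝔉.conj_comm_mem_muTorsion hu hpq)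
  have e2 := hinfl _ hp (𝔉.conj_comm_mem_muTorsion hu hp)
  have e3 := hinfl _ hq (𝔉.conj_comm_mem_muTorsion hu hq)
  have hr : δ₀ (T.aug (ι (ι.symm (p : T.PiX) * ι.symm (q : T.PiX)))) =
      δ₀ (T.aug ((p : T.PiX) * (q : T.PiX))) := by
    rw [map_mul, ContinuousMulEquiv.apply_symm_apply, ContinuousMulEquiv.apply_symm_apply]
  rw [hr] at e1
  rw [ContinuousMulEquiv.apply_symm_apply] at e2 e3
  have e4 := hχ (ι.symm (p : T.PiX)) hp ⟨_, 𝔉.conj_comm_mem_muTorsion hu hq⟩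
    ⟨_, (𝔉.muTorsion_normal 𝔉.BN 𝔉.N).conj_mem _ (𝔉.conj_comm_mem_muTorsion hu hq)
      (𝔉.sgpCap (𝔉.ρ (ι.symm (p : T.PiX))))⟩ rfl
  change m _ = T.chi (T.aug (ι.toMulEquiv (ι.symm (p : T.PiX)))) (m _) at e4
  rw [e3] at e4
  change δ₀ (T.aug ((p : T.PiX) * (q : T.PiX))) =
    δ₀ (T.aug (p : T.PiX)) * T.chi (T.aug (p : T.PiX)) (δ₀ (T.aug (q : T.PiX)))
  have hιp : ι.toMulEquiv (ι.symm (p : T.PiX)) = (p : T.PiX) := ι.apply_symm_apply _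
  rw [hιp] at e4
  rw [← e1, ← e2, ← e4, ← map_mul m]
  congr 1
  apply Subtype.ext
  change _ = (_ * _ : Aut 𝔉.BN)
  simp only [map_mul, mul_inv_rev]
  group

/-- **Conjugation by a constant IS a Kummer cocycle shift**: under `hinfl`, transport along
`E^Π_N ≃ₜ* Π^tp_Y[μ_N]` carries conjugation by `(u, 1)` on `E^Π_N` to abc-iut-L2-t2's
`CycEnvelope.shift` by the inflated cocycle `δ₀ ∘ aug` — the generator of the `K^×`-part of `D_Y`
attached to the constant (Def. 2.13 (i) p.47: "the image of `K^×`").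
[cite: MochizukiEtTh2009, Lem 5.9 (iv) p.106 (PRIMS p.332)] -/
theorem congr_conj_const_eq_shift {u : Aut 𝔉.BN} (huU : u ∈ 𝔉.units 𝔉.BN)
    (hu : 𝔉.ActsByCyclotome u)
    (hn : ((u, 1) : Aut 𝔉.BN × 𝔉.PiX) ∈ Subgroup.normalizer (𝔉.EPiN : Set (Aut 𝔉.BN × 𝔉.PiX)))
    (δ₀ : T.G → T.mu)
    (hinfl : ∀ (y : 𝔉.PiX) (hy : y ∈ 𝔉.PiY)
      (hc : u * 𝔉.sgpCap (𝔉.ρ y) * u⁻¹ * (𝔉.sgpCap (𝔉.ρ y))⁻¹ ∈ 𝔉.muTorsion 𝔉.BN 𝔉.N),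
      m ⟨_, hc⟩ = δ₀ (T.aug (ι y))) :
    MulAut.congr (𝔉.envContIso H T ι m hY hχ).toMulEquiv
        (𝔉.EPiN.normalizerMonoidHom ⟨(u, 1), hn⟩) =
      CycEnvelope.shift (𝔉.isEnvCocycle_of_inflated T ι m hY hχ hu δ₀ hinfl) := by
  apply MulEquiv.ext
  intro z
  obtain ⟨x, rfl⟩ := (𝔉.envContIso H T ι m hY hχ).surjective z
  change (𝔉.envContIso H T ι m hY hχ) (𝔉.EPiN.normalizerMonoidHom ⟨(u, 1), hn⟩
      ((𝔉.envContIso H T ι m hY hχ).symm (𝔉.envContIso H T ι m hY hχ x))) = _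
  rw [ContinuousMulEquiv.symm_apply_apply]
  change 𝔉.envIso H T ι.toMulEquiv m hY hχ (𝔉.EPiN.normalizerMonoidHom ⟨(u, 1), hn⟩ x) =
    ⟨(𝔉.envIso H T ι.toMulEquiv m hY hχ x).left *
        δ₀ (T.aug ((𝔉.envIso H T ι.toMulEquiv m hY hχ x).right : T.PiX)),
      (𝔉.envIso H T ι.toMulEquiv m hY hχ x).right⟩
  rw [𝔉.envIso_conj_const H T ι m hY hχ huU hu hn x,
    hinfl x.1.2 x.2.2.1 (𝔉.conj_comm_mem_muTorsion hu x.2.2.1)]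
  rfl

/-- **`constOut ↦ kummerOut`, one constant at a time**: under `hinfl`, the transported outer
automorphism "conjugation by `(u, 1)`" of `E^Π_N` is a member of the `K^×`-part `kummerOut` of `D_Y`.
[cite: MochizukiEtTh2009, Lem 5.9 (iv) p.106 (PRIMS p.332)] -/
theorem transport_conjOut_const_mem_kummerOut {u : Aut 𝔉.BN}
    (huU : u ∈ 𝔉.units 𝔉.BN) (hu : 𝔉.ActsByCyclotome u)
    (hn : ((u, 1) : Aut 𝔉.BN × 𝔉.PiX) ∈ Subgroup.normalizer (𝔉.EPiN : Set (Aut 𝔉.BN × 𝔉.PiX)))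
    (δ₀ : T.G → T.mu)
    (hinfl : ∀ (y : 𝔉.PiX) (hy : y ∈ 𝔉.PiY)
      (hc : u * 𝔉.sgpCap (𝔉.ρ y) * u⁻¹ * (𝔉.sgpCap (𝔉.ρ y))⁻¹ ∈ 𝔉.muTorsion 𝔉.BN 𝔉.N),
      m ⟨_, hc⟩ = δ₀ (T.aug (ι y))) :
    TopOut.transport (𝔉.envContIso H T ι m hY hχ) (𝔉.conjOut ⟨(u, 1), hn⟩) ∈ T.kummerOut := by
  have key := 𝔉.congr_conj_const_eq_shift H T ι m hY hχ huU hu hn δ₀ hinfl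
  have hc : CycEnvelope.shift (𝔉.isEnvCocycle_of_inflated T ι m hY hχ hu δ₀ hinfl) ∈
      contMulAut T.env := by
    rw [← key]
    exact conjAut_mem_contMulAut _ (𝔉.normalizerMonoidHom_mem_contMulAut _)
  refine ⟨δ₀, 𝔉.isEnvCocycle_of_inflated T ι m hY hχ hu δ₀ hinfl, hc, ?_⟩
  change TopOut.mk _ (conjContAut _ _) = TopOut.mk _ ⟨_, hc⟩
  congr 1
  exact Subtype.ext key

/-- **`constOut ↦ D_Y`**: under the inflation hypothesis for every `u ∈ (O_K^×)^{1/N}` (and the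
printed facts `Facts`, which give `(O_K^×)^{1/N} = ` the elements of `O^×(B_N)` acting by `μ_N(B_N)`,
Lemma 5.8), the transported outer action of the constants (abc-iut-L2-t4's `constOut`) lies in `D_Y`.
[cite: MochizukiEtTh2009, Lem 5.9 (iv) p.106 (PRIMS p.332)] -/
theorem image_constOut_subset_DY (h8 : 𝔉.ConstantsEqNormalizer)
    (hinflAll : ∀ u ∈ 𝔉.OKxRootN, ∃ δ₀ : T.G → T.mu, ∀ (y : 𝔉.PiX) (hy : y ∈ 𝔉.PiY)
      (hc : u * 𝔉.sgpCap (𝔉.ρ y) * u⁻¹ * (𝔉.sgpCap (𝔉.ρ y))⁻¹ ∈ 𝔉.muTorsion 𝔉.BN 𝔉.N),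
      m ⟨_, hc⟩ = δ₀ (T.aug (ι y))) :
    TopOut.transport (𝔉.envContIso H T ι m hY hχ) '' 𝔉.constOut h8 ⊆ (T.DY : Set _) := by
  rintro _ ⟨_, ⟨u, rfl⟩, rfl⟩
  obtain ⟨δ₀, hδ₀⟩ := hinflAll u u.2
  have huU : (u : Aut 𝔉.BN) ∈ 𝔉.units 𝔉.BN := 𝔉.OKxRootN_le_units u.2
  have hu : 𝔉.ActsByCyclotome u := ((H.constantsActByCyclotome u).mp u.2).2
  have hn : (((u : Aut 𝔉.BN), 1) : Aut 𝔉.BN × 𝔉.PiX) ∈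
      Subgroup.normalizer (𝔉.EPiN : Set (Aut 𝔉.BN × 𝔉.PiX)) := by
    have hu2 : (u : Aut 𝔉.BN) ∈ 𝔉.units 𝔉.BN ⊓ Subgroup.normalizer (𝔉.EN : Set (Aut 𝔉.BN)) :=
      h8 ▸ u.2
    exact 𝔉.liftConst_mem_normalizer hu2.1 hu2.2
  exact Subgroup.subset_closure (Or.inl
    (𝔉.transport_conjOut_const_mem_kummerOut H T ι m hY hχ huU hu hn δ₀ hδ₀))

/-- **`ConstOutTransported` REDUCED**: the named hypothesis `ConstOutTransported` of
`Discharge/Sec5EnvelopeTopology.lean` (the `K^×`-part of `D ↦ D_Y`, first half) holds as soon as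
(a) the Kummer cocycle of every constant `u ∈ (O_K^×)^{1/N}` is inflated from `G_K` and (b) the
residual parameter `DK` of abc-iut-L2-t4's `frdBiThetaEnv` is transported into `D_Y`.
[cite: MochizukiEtTh2009, Lem 5.9 (iv) p.106 (PRIMS p.332)] -/
theorem constOutTransported_of (h8 : 𝔉.ConstantsEqNormalizer)
    (DK : Set (TopOut 𝔉.EPiN))
    (hinflAll : ∀ u ∈ 𝔉.OKxRootN, ∃ δ₀ : T.G → T.mu, ∀ (y : 𝔉.PiX) (hy : y ∈ 𝔉.PiY)
      (hc : u * 𝔉.sgpCap (𝔉.ρ y) * u⁻¹ * (𝔉.sgpCap (𝔉.ρ y))⁻¹ ∈ 𝔉.muTorsion 𝔉.BN 𝔉.N),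
      m ⟨_, hc⟩ = δ₀ (T.aug (ι y)))
    (hDK : TopOut.transport (𝔉.envContIso H T ι m hY hχ) '' DK ⊆ (T.DY : Set _)) :
    𝔉.ConstOutTransported H h8 DK T ι m hY hχ := by
  change _ '' (_ ∪ _) ⊆ _
  rw [Set.image_union]
  exact Set.union_subset (𝔉.image_constOut_subset_DY H T ι m hY hχ h8 hinflAll) hDK

end Constants

end ThetaFrobenioid

end Literature.AnabelianGeometry.EtaleTheta
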